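import Literature.AnabelianGeometry.EtaleTheta.ThetaCoversTemperedModelDefs
import HarnessLib

/-!
# A MODEL of `ThetaCovers.TemperedCoverData` ([EtTh] §2), part 2: the orbicurve `C̲̲` of type `(1, l-torsΘ)±`
# (Def. 2.3) in the model — the data `(Π_C̲, ι̲, E = Im(s_ι), S)` of Prop. 2.2 and `Π_C̲̲ := (S·E)·⟨ι̲⟩`

S. Mochizuki, *The étale theta function …*, Publ. RIMS **45** (2009) [MochizukiEtTh2009], §2, Def. 2.1 – Def. 2.3
(PDF pp.36–38).  abc-iut cell, layer L2, L2-lead R125 → seat abc-iut-w5-d118 («NV-L2/TemperedCoverData MODEL»).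
CONSISTENCY WITNESS / TOY (continuation of `ThetaCoversTemperedModelDefs.lean`, same honest labels); PROOF-ONLY
(0 definitions: the data `Π_C̲`, `E`, `ι̲`, `Π_C̲̲` are the `def`s `HpM`, `EM`, `iotaM`, `PiCuuM` of the defs file).

In the model `Π_C = Â × Ẑ` (coordinates `Φ : Π_C → (ℤ/l × ℤ/l) ⋊ D_l`, `Ψ : Π_C → ℤ/l`): `Π_C̲ := Φ⁻¹(heisPiCu)`
(the toy's `(ℤ/l × ℤ/l) ⋊ {1, s}`), `Π_X̲ = Π_C̲ ∩ Π_X = Φ⁻¹{rotation index 0}`, `ι̲ := (η_A(s, 1), 1)`,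
`E := Π_X̲ ∩ Ker Ψ` (the `(−1)`-eigenspace datum: `s` acts by `−1` on the toy's coordinate `b`), the splitting
`S := Ker(Δ_X ↠ Δ̄_X)` (`G_K = 1`), and `Π_C̲̲ := (S · E) · ⟨ι̲⟩` (Def. 2.3) — PROVED to be of type `(1, l-torsΘ)±`
(`isTypeLTorsThetaPm_PiCuuM`) and open.  [cite: MochizukiEtTh2009, Def 2.3 p.38]
-/

noncomputable section

namespace Literature.AnabelianGeometry.EtaleTheta

namespace ThetaCovers

namespace TemperedModel

open Multiplicative HeisenbergWitness Literature.AnabelianGeometry.SemiGraphs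
  Literature.AnabelianGeometry.EtaleTheta.SettingModel

variable (l : ℕ) [NeZero l]

/-! ## 2. Coordinates -/

/-- `Φ ι̲ = s`. (toy bookkeeping) [cite: MochizukiEtTh2009, Prop 2.2 p.36] -/
@[simp] theorem Phi_iotaM : Phi l (iotaM l) = SemidirectProduct.inr (DihedralGroup.sr 0) := by
  rw [iotaM, Phi_eta]

/-- `Ψ ι̲ = 1`. (toy bookkeeping) [cite: MochizukiEtTh2009, Prop 2.2 p.36] -/
@[simp] theorem Psi_iotaM : Psi l (iotaM l) = 1 := by
  have h : Psi l (iotaM l) = piL l 1 := rfl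
  rw [h, map_one]

/-- `ι̲ ∉ Π_X` (`s` is a reflection). (toy bookkeeping) [cite: MochizukiEtTh2009, Prop 2.2 p.36] -/
theorem iotaM_not_mem_PiXM : iotaM l ∉ PiXM l := by
  intro h
  have h' : Phi l (iotaM l) ∈ heisPiX l := h
  rw [Phi_iotaM] at h'
  obtain ⟨i, hi⟩ := (mem_heisPiX l).mp h'
  cases hi

omit [NeZero l] in
/-- `ι̲² = 1`. (toy bookkeeping) [cite: MochizukiEtTh2009, Prop 2.2 (iii) p.37] -/
theorem iotaM_mul_self : iotaM l * iotaM l = 1 := by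
  have hA : ((SemidirectProduct.inr (DihedralGroup.sr 0), 1) : heisPiC l × Multiplicative (ZMod 2)) *
      (SemidirectProduct.inr (DihedralGroup.sr 0), 1) = 1 := by
    refine Prod.ext ?_ (mul_one _)
    change SemidirectProduct.inr (DihedralGroup.sr 0) * SemidirectProduct.inr (DihedralGroup.sr 0) =
      (1 : heisPiC l)
    rw [← map_mul, DihedralGroup.sr_mul_sr, sub_self, ← DihedralGroup.one_def, map_one]
  refine Prod.ext ?_ (mul_one _)
  change etaCont (TA l) _ * etaCont (TA l) _ = 1
  rw [← map_mul]
  exact (congrArg (etaCont (TA l)) hA).trans (map_one _)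

/-- Membership in `Π_X̲ = Π_C̲ ∩ Π_X`: the `D_l`-component of `Φ` is trivial. (toy bookkeeping)
[cite: MochizukiEtTh2009, Def 2.1 p.36] -/
theorem mem_HpM_inf_iff (x : PiCM l) : x ∈ HpM l ⊓ PiXM l ↔ (Phi l x).right = 1 :=
  mem_heisPiCu_inf l (x := Phi l x)

/-- `Π_C̲ ∩ Π_X = Φ⁻¹(Π_X̲(toy))`. (toy bookkeeping) [cite: MochizukiEtTh2009, Def 2.1 p.36] -/
theorem HpM_inf_eq : HpM l ⊓ PiXM l = (heisPiCu l ⊓ heisPiX l).comap (Phi l) :=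
  (Subgroup.comap_inf _ _ _).symm

/-- `Δ̄_Θ-preimage ⊆ Π_X̲`. (toy bookkeeping) [cite: MochizukiEtTh2009, Def 2.1 p.36] -/
theorem barThetaM_le_HpM_inf : barThetaM l ≤ HpM l ⊓ PiXM l := by
  intro x hx
  exact (mem_HpM_inf_iff l x).mpr ((mem_heisTheta l).mp hx).1

/-- `E` is open. (toy bookkeeping) [cite: MochizukiEtTh2009, Prop 2.2 (i) p.37] -/
theorem isOpen_EM : IsOpen (EM l : Set (PiCM l)) := by
  rw [EM, HpM_inf_eq]
  change IsOpen (((Phi l) ⁻¹' ((heisPiCu l ⊓ heisPiX l : Subgroup (heisPiC l)) : Set (heisPiC l))) ∩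
    ((Psi l).ker : Set (PiCM l)))
  exact (isOpen_preimage_Phi l _).inter (isOpen_ker_Psi l)

/-- `Π_C̲̲` is open (it contains the open subgroup `E`). (toy bookkeeping) [cite: MochizukiEtTh2009, Def 2.3 p.38] -/
theorem isOpen_PiCuuM : IsOpen (PiCuuM l : Set (PiCM l)) :=
  Subgroup.isOpen_mono (le_sup_right.trans le_sup_left) (isOpen_EM l)

/-! ## 3. The rotation-index character on `Π_X` and the type `(1, l-tors)±` of `Π_C̲` -/

omit [NeZero l] in
/-- The toy's rotation character vanishes exactly on `Π_X̲ = heisPiCu ∩ heisPiX`. (toy bookkeeping)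
[cite: MochizukiEtTh2009, Def 2.1 p.36] -/
theorem rotChar_eq_one_iff (g : heisPiX l) : rotChar l g = 1 ↔ (g : heisPiC l) ∈ heisPiCu l ⊓ heisPiX l := by
  obtain ⟨i, hi⟩ := (mem_heisPiX l).mp g.2
  rw [mem_heisPiCu_inf, hi, DihedralGroup.one_def, DihedralGroup.r.injEq]
  constructor
  · intro h
    have := congrArg toAdd h
    simpa [rotChar, hi] using this
  · intro h
    apply toAdd.injective
    simp [rotChar, hi, h]

/-- The rotation character of the model, `Π_X → heisPiX → ℤ/l` (`rotChar ∘ Φ`), is onto. (toy bookkeeping)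
[cite: MochizukiEtTh2009, Def 2.1 p.36] -/
theorem rotChar_comp_surjective :
    Function.Surjective ((rotChar l).comp ((Phi l).subgroupComap (heisPiX l))) := by
  intro y
  obtain ⟨a, rfl⟩ := Multiplicative.ofAdd.surjective y
  obtain ⟨x, hx⟩ := Phi_surjective l (SemidirectProduct.inr (DihedralGroup.r a))
  have hxX : x ∈ PiXM l := by
    change Phi l x ∈ heisPiX l
    rw [hx]
    exact (mem_heisPiX l).mpr ⟨a, rfl⟩
  refine ⟨⟨x, hxX⟩, ?_⟩
  change ofAdd (rotIdx l (Phi l x).right) = ofAdd a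
  rw [hx, SemidirectProduct.right_inr, rotIdx_r]

variable (hl : Odd l)

/-- **`Π_C̲` is of type `(1, l-tors)±`** in the model (Def. 2.1): `Π_X̲ = Π_C̲ ∩ Π_X` is the kernel of the rotation
character `Π_X ↠ ℤ/l`, contains `Δ̄_Θ-preimage ⊇ D_x`, and has index `2` in `Π_C̲` — from the toy's
`isTypeLTorsPm_heisPiCu` through the surjection `Φ`. [cite: MochizukiEtTh2009, Def 2.1 p.36] -/
theorem isTypeLTorsPm_HpM : (coverDataAx l hl).toCoverData.IsTypeLTorsPm (HpM l) := by
  refine ⟨⟨inf_le_right, ⟨(rotChar l).comp ((Phi l).subgroupComap (heisPiX l)), rotChar_comp_surjective l,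
    fun g => ?_⟩, barThetaM_le_HpM_inf l, ?_, barThetaM_le_HpM_inf l⟩, ?_⟩
  · -- kernel of the rotation character
    change rotChar l ((Phi l).subgroupComap (heisPiX l) g) = 1 ↔ (g : PiCM l) ∈ HpM l ⊓ PiXM l
    rw [rotChar_eq_one_iff]
    rfl
  · -- `Π_X̲ · Δ_X = Π_X` (`Δ_X = Π_X`)
    change (HpM l ⊓ PiXM l) ⊔ (PiXM l ⊓ (1 : PiCM l →* PUnit.{1}).ker) = PiXM l
    rw [MonoidHom.ker_one, inf_top_eq]
    exact le_antisymm (sup_le inf_le_right le_rfl) le_sup_right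
  · -- `[Π_C̲ : Π_X̲] = 2`
    change (HpM l ⊓ PiXM l).relIndex (HpM l) = 2
    rw [HpM_inf_eq, HpM, Subgroup.relIndex_comap,
      Subgroup.map_comap_eq_self_of_surjective (Phi_surjective l)]
    exact (isTypeLTorsPm_heisPiCu l hl).relIndex_two

/-- `ι̲` is an inversion for `Π_C̲` (`ι̲ ∈ Π_C̲ ∩ Δ_C ∖ Π_X`). [cite: MochizukiEtTh2009, Prop 2.2 p.36] -/
theorem isInversion_iotaM : (coverDataAx l hl).toCoverData.IsInversion (HpM l) (iotaM l) := by
  refine ⟨?_, mem_ker_oneM l _, iotaM_not_mem_PiXM l⟩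
  change Phi l (iotaM l) ∈ heisPiCu l
  rw [Phi_iotaM]
  exact Or.inr rfl

/-- `E ∩ Δ̄_Θ-preimage = Ker`. (toy bookkeeping) [cite: MochizukiEtTh2009, Prop 2.2 (i) p.37] -/
theorem EM_inf_barThetaM : EM l ⊓ barThetaM l = barKerM l := by
  refine le_antisymm ?_ ?_
  · rintro x ⟨⟨-, hxK⟩, hxT⟩
    exact ⟨hxT, hxK⟩
  · rintro x ⟨hxT, hxK⟩
    exact ⟨⟨barThetaM_le_HpM_inf l hxT, hxK⟩, hxT⟩

/-- `E · Δ̄_Θ-preimage = Π_X̲` (every `x ∈ Π_X̲` is `(x t⁻¹) · t` with `t ∈ 1 × Ẑ`, `Ψ t = Ψ x`). (toy bookkeeping)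
[cite: MochizukiEtTh2009, Prop 2.2 (i) p.37] -/
theorem EM_sup_barThetaM : EM l ⊔ barThetaM l = HpM l ⊓ PiXM l := by
  refine le_antisymm (sup_le inf_le_left (barThetaM_le_HpM_inf l)) fun x hx => ?_
  obtain ⟨z, hz⟩ := Psi_surjective_right l (Psi l x)
  have ht : ((1 : Ahat l), z) ∈ barThetaM l := one_prod_mem_barThetaM l z
  have hE : x * ((1 : Ahat l), z)⁻¹ ∈ EM l := by
    refine ⟨Subgroup.mul_mem _ hx (Subgroup.inv_mem _ (barThetaM_le_HpM_inf l ht)), ?_⟩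
    show x * ((1 : Ahat l), z)⁻¹ ∈ (Psi l).ker
    rw [MonoidHom.mem_ker, map_mul, map_inv, hz, mul_inv_cancel]
  have : x = x * ((1 : Ahat l), z)⁻¹ * ((1 : Ahat l), z) := by rw [inv_mul_cancel_right]
  rw [this]
  exact Subgroup.mul_mem _ (Subgroup.mem_sup_left hE) (Subgroup.mem_sup_right ht)

omit [NeZero l] in
/-- In the toy, `s` conjugates an element of `Π_X̲ = {(b, c)}` to its inverse modulo `heisTheta`:
`s e s⁻¹ e ∈ heisTheta`. (toy bookkeeping) [cite: MochizukiEtTh2009, Prop 2.2 (i) p.37] -/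
theorem heis_s_conj_mul_mem {e : heisPiC l} (he : e.right = 1) :
    SemidirectProduct.inr (DihedralGroup.sr 0) * e * (SemidirectProduct.inr (DihedralGroup.sr 0))⁻¹ * e ∈
      heisTheta l :=
  (mem_heisTheta l).mpr ⟨by simp [he], by simp [he]⟩

omit [NeZero l] in
/-- In the toy, conjugation by `s` preserves `Π_X̲ = {(b, c)}`. (toy bookkeeping) [cite: MochizukiEtTh2009, Prop 2.2 (i) p.37] -/
theorem heis_s_conj_right {e : heisPiC l} (he : e.right = 1) :
    (SemidirectProduct.inr (DihedralGroup.sr 0) * e * (SemidirectProduct.inr (DihedralGroup.sr 0))⁻¹).right = 1 := by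
  simp [he]

/-- **`E` is the `(−1)`-eigenspace datum `Im(s_ι)`** of Prop. 2.2 (i) for `(Π_X̲, Π_C̲, ι̲)` in the model.
[cite: MochizukiEtTh2009, Prop 2.2 (i) p.37] -/
theorem isMinusEigen_EM :
    (coverDataAx l hl).toCoverData.IsMinusEigen (HpM l ⊓ PiXM l) (HpM l) (iotaM l) (EM l) := by
  haveI : (Psi l).ker.Normal := MonoidHom.normal_ker _
  refine ⟨?_, ?_, ?_, EM_inf_barThetaM l, ?_, ?_, ?_, ?_⟩
  · -- `Ker ⊆ E`
    exact fun x hx => ⟨barThetaM_le_HpM_inf l hx.1, hx.2⟩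
  · -- `E ⊆ Π_X̲ ∩ Δ_C`
    change EM l ≤ (HpM l ⊓ PiXM l) ⊓ (1 : PiCM l →* PUnit.{1}).ker
    rw [MonoidHom.ker_one, inf_top_eq]
    exact inf_le_left
  · -- normalised by `Π_X̲`
    intro g hg e he
    exact ⟨Subgroup.mul_mem _ (Subgroup.mul_mem _ hg he.1) (Subgroup.inv_mem _ hg),
      ‹(Psi l).ker.Normal›.conj_mem e he.2 g⟩
  · -- `E · Δ̄_Θ = Π_X̲ ∩ Δ_C`
    change EM l ⊔ barThetaM l = (HpM l ⊓ PiXM l) ⊓ (1 : PiCM l →* PUnit.{1}).ker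
    rw [MonoidHom.ker_one, inf_top_eq]
    exact EM_sup_barThetaM l
  · -- `ι̲` acts by `−1` on `E / Ker`
    intro e he
    have he1 : (Phi l e).right = 1 := (mem_HpM_inf_iff l e).mp he.1
    refine ⟨?_, ?_⟩
    · change Phi l (iotaM l * e * (iotaM l)⁻¹ * e) ∈ heisTheta l
      rw [map_mul, map_mul, map_mul, map_inv, Phi_iotaM]
      exact heis_s_conj_mul_mem l he1
    · have he2 : Psi l e = 1 := he.2
      show iotaM l * e * (iotaM l)⁻¹ * e ∈ (Psi l).ker
      rw [MonoidHom.mem_ker, map_mul, map_mul, map_mul, map_inv, he2, Psi_iotaM]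
      simp
  · -- `ι̲` acts by `+1` on `Δ̄_Θ`
    intro t ht
    refine ⟨?_, Psi_comm_mem_ker l _ _⟩
    change Phi l (iotaM l * t * (iotaM l)⁻¹ * t⁻¹) ∈ heisTheta l
    rw [map_mul, map_mul, map_mul, map_inv, map_inv, Phi_iotaM,
      heis_inv_theta l hl (c := SemidirectProduct.inr (DihedralGroup.sr 0)) ?_ ht]
    · exact (heisTheta l).one_mem
    · intro h
      obtain ⟨i, hi⟩ := (mem_heisPiX l).mp h
      cases hi
  · -- `ι̲` normalises `E`
    intro e he
    have he1 : (Phi l e).right = 1 := (mem_HpM_inf_iff l e).mp he.1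
    refine ⟨(mem_HpM_inf_iff l _).mpr ?_, ?_⟩
    · rw [map_mul, map_mul, map_inv, Phi_iotaM]
      exact heis_s_conj_right l he1
    · have he2 : Psi l e = 1 := he.2
      show iotaM l * e * (iotaM l)⁻¹ ∈ (Psi l).ker
      rw [MonoidHom.mem_ker, map_mul, map_mul, map_inv, he2, mul_one, mul_inv_cancel]

/-- `S := Ker(Δ_X ↠ Δ̄_X)` is a splitting of `D̄_x ↠ G_K = 1` in the model. [cite: MochizukiEtTh2009, Prop 2.2 (ii) p.37] -/
theorem isSplitting_barKerM : (coverDataAx l hl).toCoverData.IsSplitting (barKerM l) :=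
  ⟨le_rfl, inf_le_left.trans le_sup_left, inf_eq_left.mpr inf_le_left, fun _ => ⟨1, Subsingleton.elim _ _⟩⟩

/-- **`Π_C̲̲` is of type `(1, l-torsΘ)±`** in the model (Def. 2.3 / Prop. 2.2 (iii)): the data
`(Π_C̲, E, S, ι̲)` above with `ι̲² = 1 ∈ Ker`. [cite: MochizukiEtTh2009, Def 2.3 p.38] -/
theorem isTypeLTorsThetaPm_PiCuuM : (coverDataAx l hl).toCoverData.IsTypeLTorsThetaPm (PiCuuM l) :=
  ⟨HpM l, EM l, barKerM l, iotaM l, isTypeLTorsPm_HpM l hl, isInversion_iotaM l hl,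
    by rw [iotaM_mul_self]; exact (barKerM l).one_mem, isMinusEigen_EM l hl, isSplitting_barKerM l hl, rfl⟩

end TemperedModel

end ThetaCovers

end Literature.AnabelianGeometry.EtaleTheta
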